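/-
Copyright: public-audit package `pub-balaban` (b2b-balaban), seat pv28-g7. Released under Apache 2.0 like Mathlib.
-/
import Literature.MathematicalPhysics.QuantumFieldTheory.Balaban1983to89.T4TiltModulus
import Literature.MathematicalPhysics.QuantumFieldTheory.Balaban1983to89.T4AvgDerivBound
import Literature.MathematicalPhysics.QuantumFieldTheory.Balaban1983to89.MatrixNorms

/-!
# T4TiltOscillation — the EXPLICIT free constant `κ(u)` and oscillation `ε(u)` of the Gibbs-tilt hypothesis of
# `T4TiltModulus` for windowed WILSON-TYPE densities: the algebraic half of caveat (LOG) (cell `pub-balaban`,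
# T4-DAG v10 §5; self-proposed kernel sub-row T4-O3.E-iii-b-G7-LOG* of the pv28 lineage, gen 7, below pv16-g9's
# row T4-O3.E-iii-b-G7-TILT*; kernel bookkeeping, Mathlib + three cell modules BY NAME)

HONEST FRAMING (cell `pub-balaban`, T4-DAG PAGE 1).  The cell's T4 target is the existence AND uniqueness of the
continuum limit of Bałaban's unit-scale averaged loop expectations on a finite torus — a constructive-QFT statement
strictly beyond ultraviolet stability ([Balaban1989LargeFieldII] Thm 1 p. 355); it is NOT the Yang–Mills mass gap and
NOT the Clay problem.  This module is ELEMENTARY and asserts NOTHING about Bałaban's papers: no statement of the series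
B1–B16 is quoted, used or typed here, and no estimate of the series is proved.  pv16-g9's `T4TiltModulus` discharges
the Lipschitz-in-the-exterior shapes `MeanLipschitz` / the pair-mean binder `hL` on the TILT DOMAIN
`tiltDom s old u₀ κ ε ε₀ = {u | FibreRatioClose s old u u₀ (κ u) (ε u), 0 ≤ ε u ≤ ε₀}` for ARBITRARY functions
`κ, ε` of the exterior, and supplies `FibreRatioClose` for Gibbs-form densities `old = χ·e^{h}` from the INPUT
`|h(u←y) − h(u₀←y) − κ| ≤ ε` on the fibre (`fibreRatioClose_of_exp`, its caveat (LOG): «the ESTIMATE of the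
oscillation `ε(u)` by the deviation of `u` from `u₀` is NOT proved», GAPS G-pv28g6-1′ of this lineage).  THIS MODULE
COMPUTES `κ(u)` AND `ε(u)` IN CLOSED FORM for exponents of Wilson type `h(U) = Σ_i c_i Re tr U(w_i)` — any finite
family of lattice WORDS `w_i` in the bond variables and their inverses with real weights `c_i` (the Wilson action
`wilsonAction w` of the tree, B12 (0.2), is the family of plaquette words, `exp_neg_mul_wilsonAction`; `ζ`-weighted
plaquette families are covered by per-word weights) — and PROVES the input inequality with them, at kernel level, from
ONE second-order trace inequality `ReTrQuad G` on the `GaugeGroup` interface, itself DISCHARGED in the tree's unitary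
model (`reTrQuad_unitaryGroup`, `reTrQuad_specialUnitaryGroup`; pattern of `T4ReTrLipUnitary`).  OUTPUT, by name:
`u ∈ tiltDom s old u₀ (kappa …) (eps …) ε₀` for every exterior `u` with `eps … u u₀ ≤ ε₀` (`mem_tiltDom_hsum`,
`mem_tiltDom_wilsonAction`), and a FULLY EXPLICIT instance with NO hypothesis shape left — the sharp fibre window times
the Wilson Gibbs factor in `SU(n)` (`mem_tiltDom_fibreWindow_wilson_SU`).  Every declaration is `[folklore]`.  Value:
kernel lemma + bookkeeping of an implication ⇐ a named input; NOT summit progress.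

## The mechanism (O1)–(O5), as typed here

* (O1) §1, THE SECOND-ORDER TRACE INEQUALITY.  Hypothesis SHAPE `ReTrQuad G : |reTr(gh) − reTr g − reTr h + 1| ≤
  dist1 g · dist1 h` — in a unitary matrix model `gh − g − h + 1 = (g − 1)(h − 1)`, so this is
  `|Re tr((g−1)(h−1))/n| ≤ ‖g − 1‖·‖h − 1‖` (`nReTr_quad`: additivity of `UnitaryModel.nReTr`, B7 (20) `|tr X| ≤ |X|`
  as f1's `MatrixNorms.abs_nReTr_le_opNorm`, `Matrix.l2_opNorm_mul`); discharged for `GaugeGroup.ofUnitaryRep`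
  (`reTrQuad_ofUnitaryRep`) and the tree's instances on `U(n)`, `SU(n)`.  It is the exact form of «the first-order
  variation of `Re tr W` in one factor vanishes at `W = 1`»: `reTr(Vd) − reTr V = (reTr d − 1) ± dist1 V · dist1 d`.
  Elementary identities on the interface: `reTr (gh) = reTr (hg)`, `dist1 (gh) = dist1 (hg)` (from `reTr_conj`,
  `dist1_conj`), `dist1 (h g⁻¹) = dist1 (h⁻¹ g)`, `|reTr d − 1| ≤ Lip·dist1 d` under `T4AvgDerivBound.ReTrLip G Lip`.
* (O2) §2, THE WORD EXPANSION LEMMA (abstract group, `ReTrQuad` only).  A lettered word is a list of triples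
  `(g_k, x_k, x_k⁰)` (fibre factor, new exterior factor, old exterior factor), `W = Π g_k x_k`, `W⁰ = Π g_k x_k⁰`,
  `d_k = (x_k⁰)⁻¹ x_k`, `δ = Σ dist1 d_k`, `κ = Σ (reTr d_k − 1)`, `q = Σ_{i<k} dist1 d_i dist1 d_k ≤ δ²/2`.  Then for
  every left multiplier `a`: `dist1(aW) ≤ dist1(aW⁰) + δ` (`dist1_mul_wNew_le`) and
  `|reTr(aW) − reTr(aW⁰) − κ| ≤ dist1(aW⁰)·δ + q` (`abs_reTr_wNew_sub_le`; induction on the word with a free left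
  multiplier: replacing the exterior letters one at a time, each replacement reads `reTr(Vd) − reTr V` for a cyclic
  conjugate `V` of the current word).  THE POINT: `κ` does NOT depend on the fibre factors `g_k`.
* (O3) §3, THE MODEL.  Letters `(b, ±)` read `U(b)^{±1}` off a configuration (`letter`), words have holonomies
  `wordHol U w` (the tree's `GaugeField.plaqHol U p` is `wordHol U (plaqWord p)`, `plaqHol_eq_wordHol`); through a
  fibre `s` (bond variables `y` on `s`, exterior `u`: the configuration `u←y = updateFinset u s y` of pv04/pv16) a word
  splits into fibre letters (exterior-blind, `letter_updateFinset_of_mem`) and exterior letters (fibre-blind,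
  `letter_updateFinset_of_not_mem`), i.e. it IS a lettered word of (O2) (`letterTriple`, four bridge lemmas), whence
  the PER-WORD BOUND `|reTr (u←y)(w) − reTr (u₀←y)(w) − κ_w(u,u₀)| ≤ dist1((u₀←y)(w))·dev_w(u,u₀) + dev_w(u,u₀)²/2`
  (`abs_reTr_wordHol_sub_le`) with `dev_w(u,u₀) = Σ_{exterior letters} |u₀(b)⁻¹u(b) − 1|` (`wdev`) and
  `κ_w(u,u₀) = Σ_{exterior letters} (Re tr(u₀(b)⁻¹u(b)) − 1)` (`wkap`), BOTH INDEPENDENT OF `y`;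
  `|κ_w| ≤ Lip·dev_w` (`abs_wkap_le`), `dev_w ≤ |w|·D` under a letterwise deviation bound (`wdev_le_length_mul`).
* (O4) §4, FINITE FAMILIES.  For `h = Σ_i c_i Re tr U(w_i)` (`hsum`): `κ(u) := Σ_{w_i misses s} c_i (Re tr u(w_i) −
  Re tr u₀(w_i)) + Σ_{w_i meets s} c_i κ_{w_i}(u,u₀)` (`kappa`) and `ε(u) := Σ_{w_i meets s} |c_i| (η_i dev_{w_i}(u,u₀)
  + dev_{w_i}(u,u₀)²/2)` (`eps`), and THE OSCILLATION THEOREM `|h(u←y) − h(u₀←y) − κ(u)| ≤ ε(u)` whenever the words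
  meeting the fibre have holonomy within `η_i` of `1` at `u₀←y` (`abs_hsum_sub_le`; words missing the fibre are
  absorbed EXACTLY by `κ`, `wordHol_updateFinset_of_forall_not_mem`).  `κ(u₀) = ε(u₀) = 0`; the coarse sizing
  `ε(u) ≤ Σ_{mixed} |c_i| (η_i |w_i| D + (|w_i| D)²/2)` (`eps_le_of_bdev_le`) — FIRST ORDER in the exterior deviation
  `D`, with coefficient (Σ over MIXED words only of `|c_i| η_i |w_i|`).
* (O5) §5, DISCHARGE BY NAME.  Support-restricted twins `ratioClose_of_exp_on` / `fibreRatioClose_of_exp_on` of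
  pv16's suppliers (the exponent hypothesis is needed only on the window `{χ(u₀←·) ≠ 0}`); the `u`-INDEPENDENT window
  hypothesis `SmallOnWindow s χ word η u₀` with two suppliers (`smallOnWindow_of_support`; letterwise
  `smallOnWindow_of_bondSmall`, `η_i = |w_i|·r`, via `dist1_wordHol_le`); then `fibreRatioClose_hsum`,
  `mem_tiltDom_hsum`, the Wilson forms `fibreRatioClose_wilsonAction`, `mem_tiltDom_wilsonAction` (the constant
  `e^{−β|plaquettes|w}` joins the window), and the explicit instance: the SHARP FIBRE WINDOW `fibreWindow s r U =
  𝟙{|U(b) − 1| ≤ r, b ∈ s}` is exterior-blind on the fibre for EVERY pair of exteriors (`fibreWindow_updateFinset`),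
  so for `old = fibreWindow s r · e^{−β A_w}` and a reference exterior `r`-close to `1` on the exterior letters of the
  plaquettes meeting `s`, every `u` with `ε(u) ≤ ε₀` lies in the tilt domain with `η ≡ 4r`
  (`mem_tiltDom_fibreWindow_wilson`; in `SU(n)` with nothing left to discharge, `mem_tiltDom_fibreWindow_wilson_SU`).

## WHAT IS NOT PROVED / NOT PRINTED (record `t4/T4-EST-O3Eiiib-G7.md` § «G7-T» of this lineage; pv16-g9's
`T4TiltModulus` header, caveats (S-TILT), (LOG), (B-INS), (SUP); `t4/T4-EST-O3Ei1.md` §4d)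

* (LOG-SIZE) The SIZING of `ε(u)` against Bałaban's parameters is NOT done here and nothing printed about it is
  asserted: with `c_i = β·w` (`β = g_k^{−2}` in the papers' normalisation), window radius `η`, exterior deviation
  scale `D` and `m` plaquettes meeting the fibre, (O4) gives `ε(u) ≲ β·m·(4ηD + 8D²)` — whether this is `O(1)` (so that
  pv16's constant `2e^{2ε₀}M` is honest) on the printed small-field windows, which carry logarithms, is the record's
  re-scoped gap (GAPS G-pv28g6-1″); the kernel statement `eps_le_of_bdev_le` is parameter-free.
* (S-TILT) The exterior-blindness `χ(u←y) = χ(u₀←y)` of the window stays a HYPOTHESIS (`hχ`) of every discharge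
  theorem except the fibre-window instance, where it holds by construction; whether Bałaban's restrictions of the
  fluctuation variables ([Balaban1989LargeFieldI] (1.101) p. 201, [Balaban1987RG1] (2.9) p. 266, as LOCATED — not
  asserted — in `T4TiltModulus` v1.0.1) are windows on the fibre variables in coordinates in which the exponent is of
  Wilson type in the SAME variables (the fibre coordinate there is the fluctuation RELATIVE to an exterior-dependent
  background) is row O3.E-i′ (α)'s reading, not decided here.  Sharp characteristic functions of MIXED plaquettes are
  NOT exterior-blind; this module does not pretend otherwise.
* `ReTrQuad G` is a hypothesis SHAPE on the abstract interface (which has no second-order axiom), discharged only in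
  the unitary model of `UnitaryModel` — exactly as `ReTrLip` in `T4ReTrLipUnitary`.
* Nothing about measurability, `fibreIntegral ≠ 0`, `MeanVanishes`, conjugation invariance or axiality is touched:
  the (T4) theorems of `T4TiltModulus` keep those hypotheses by name; this module only places exteriors IN their
  domain `tiltDom` with explicit `κ`, `ε`.

Depends on `T4TiltModulus` (pv16-g9: `RatioClose`, `fibreDensity`, `FibreRatioClose`, `tiltDom`), `MatrixNorms` (f1:
`abs_nReTr_le_opNorm`), `T4AvgDerivBound` (`ReTrLip`, the shape only), `UnitaryModel` (`nReTr`, `opDist1`, `nReTr_one`,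
`GaugeGroup.ofUnitaryRep`, `instGaugeGroupUnitaryGroup`, `instGaugeGroupSpecialUnitaryGroup`), `Setup` (`GaugeGroup`,
`GaugeField`, `PBond`, `Plaq`, `GaugeField.plaqHol`, `wilsonAction`, `Density`),
`Literature.MathematicalPhysics.QuantumLattice` (`unitaryFundamentalRep`, `fundamentalRep`,
`fundamentalRep_mem_unitaryGroup`) and Mathlib (`Matrix.l2_opNorm_mul`, `Function.updateFinset`,
`Finset.abs_sum_le_sum_abs`, `Real.exp_le_exp`, `pow_le_pow_left₀`).  All declarations [folklore]; no `[cite:]`.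
Source declarations: 101 = 79 `theorem` + 20 `def` + 1 `abbrev` + 1 `instance`.  v1 (this file): new leaf, no
declaration of another module changed.
-/

noncomputable section

open Function (updateFinset)
open scoped BigOperators

namespace Literature.MathematicalPhysics.QuantumFieldTheory.Balaban1983to89.T4TiltOscillation

open Literature.MathematicalPhysics.QuantumFieldTheory.Balaban1983to89
open Literature.MathematicalPhysics.QuantumFieldTheory.Balaban1983to89.T4TiltModulus
open Literature.MathematicalPhysics.QuantumFieldTheory.Balaban1983to89.T4AvgDerivBound (ReTrLip)
open Literature.MathematicalPhysics.QuantumFieldTheory.Balaban1983to89.UnitaryModel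

/-! ## §1  The second-order trace inequality: hypothesis shape `ReTrQuad` and its discharge in the unitary model -/

section Shape

/-- HYPOTHESIS SHAPE (second-order trace inequality) on the `GaugeGroup` interface:
`|reTr (g h) − reTr g − reTr h + 1| ≤ dist1 g · dist1 h` — in a unitary matrix model this is
`|Re tr((g − 1)(h − 1))| ≤ ‖g − 1‖·‖h − 1‖` (normalised trace, operator norm), `reTrQuad_ofUnitaryRep`.  It is the exact
form of «the first-order variation of `Re tr W` in a factor vanishes at `W = 1`».  Discharged for `U(n)`, `SU(n)` below;
NOT an axiom of the interface. [folklore] -/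
def ReTrQuad (G : Type*) [GaugeGroup G] : Prop := ∀ g h : G, |reTr (g * h) - reTr g - reTr h + 1| ≤ dist1 g * dist1 h

end Shape

section Elementary

variable {G : Type*} [GaugeGroup G]

/-- `Re tr (g h) = Re tr (h g)` (class function; from `reTr_conj`). [folklore] -/
theorem reTr_mul_comm (g h : G) : reTr (g * h) = reTr (h * g) := by
  have h1 := GaugeGroup.reTr_conj (h * g) g
  rwa [show g * (h * g) * g⁻¹ = g * h by group] at h1

/-- `|g h − 1| = |h g − 1|` (from `dist1_conj`). [folklore] -/
theorem dist1_mul_comm (g h : G) : dist1 (g * h) = dist1 (h * g) := by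
  have h1 := GaugeGroup.dist1_conj (h * g) g
  rwa [show g * (h * g) * g⁻¹ = g * h by group] at h1

/-- `|h g⁻¹ − 1| = |h⁻¹ g − 1|`: the deviation of `g` from `h` read on inverted letters. [folklore] -/
theorem dist1_mul_inv_eq (g h : G) : dist1 (h * g⁻¹) = dist1 (h⁻¹ * g) := by
  rw [← GaugeGroup.dist1_inv (h * g⁻¹), mul_inv_rev, inv_inv, dist1_mul_comm]

/-- `Re tr (h g⁻¹) = Re tr (h⁻¹ g)`. [folklore] -/
theorem reTr_mul_inv_eq (g h : G) : reTr (h * g⁻¹) = reTr (h⁻¹ * g) := by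
  rw [← GaugeGroup.reTr_inv (h * g⁻¹), mul_inv_rev, inv_inv, reTr_mul_comm]

/-- Under the first-order shape `ReTrLip G Lip` (in the tree, `T4AvgDerivBound.ReTrLip`; `Lip = 1` in the unitary model,
`T4ReTrLipUnitary.reTrLip_ofUnitaryRep`): `|reTr d − 1| ≤ Lip · dist1 d`. [folklore] -/
theorem abs_reTr_sub_one_le {Lip : ℝ} (hL : ReTrLip G Lip) (d : G) : |reTr d - 1| ≤ Lip * dist1 d := by
  have h := hL 1 d
  rwa [GaugeGroup.reTr_one, inv_one, one_mul, abs_sub_comm] at h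

end Elementary

section Unitary

open scoped Matrix.Norms.L2Operator

variable {n : Type*} [Fintype n] [DecidableEq n] [Nonempty n]

omit [DecidableEq n] [Nonempty n] in
/-- The normalised real trace is additive. [folklore] -/
theorem nReTr_add (A B : Matrix n n ℂ) : nReTr (A + B) = nReTr A + nReTr B := by
  unfold nReTr; rw [Matrix.trace_add, Complex.add_re, add_div]

omit [DecidableEq n] [Nonempty n] in
/-- … and respects subtraction. [folklore] -/
theorem nReTr_sub (A B : Matrix n n ℂ) : nReTr (A - B) = nReTr A - nReTr B := by
  unfold nReTr; rw [Matrix.trace_sub, Complex.sub_re, sub_div]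

/-- THE SECOND-ORDER TRACE INEQUALITY for complex matrices: `|Re tr(gh) − Re tr g − Re tr h + 1| ≤ ‖g − 1‖·‖h − 1‖`
(normalised trace, L²-operator norm), because `gh − g − h + 1 = (g − 1)(h − 1)`. [folklore] -/
theorem nReTr_quad (g h : Matrix n n ℂ) :
    |nReTr (g * h) - nReTr g - nReTr h + 1| ≤ opDist1 g * opDist1 h := by
  have e : nReTr (g * h) - nReTr g - nReTr h + 1 = nReTr ((g - 1) * (h - 1)) := by
    have h1 : (g - 1) * (h - 1) = g * h - g - h + 1 := by noncomm_ring
    rw [h1, nReTr_add, nReTr_sub, nReTr_sub, nReTr_one]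
  rw [e, opDist1, opDist1]
  exact (MatrixNorms.abs_nReTr_le_opNorm _).trans (Matrix.l2_opNorm_mul _ _)

/-- **`ReTrQuad` in the unitary model** `GaugeGroup.ofUnitaryRep H ρ hρ` (`dist1 h = ‖ρ h − 1‖`, `reTr h = Re tr ρ(h)/n`).
[folklore] -/
theorem reTrQuad_ofUnitaryRep {H : Type*} [Group H] (ρ : H →* Matrix n n ℂ)
    (hρ : ∀ h, ρ h ∈ Matrix.unitaryGroup n ℂ) : @ReTrQuad H (GaugeGroup.ofUnitaryRep H ρ hρ) := by
  intro g h
  show |nReTr (ρ (g * h)) - nReTr (ρ g) - nReTr (ρ h) + 1| ≤ opDist1 (ρ g) * opDist1 (ρ h)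
  rw [map_mul]
  exact nReTr_quad _ _

open Literature.MathematicalPhysics.QuantumLattice in
/-- `ReTrQuad (U(n))` for the tree's instance `instGaugeGroupUnitaryGroup`. [folklore] -/
theorem reTrQuad_unitaryGroup : ReTrQuad (Matrix.unitaryGroup n ℂ) :=
  reTrQuad_ofUnitaryRep (unitaryFundamentalRep n ℂ) fun U => U.2

open Literature.MathematicalPhysics.QuantumLattice in
/-- `ReTrQuad (SU(n))` for the tree's instance `instGaugeGroupSpecialUnitaryGroup`. [folklore] -/
theorem reTrQuad_specialUnitaryGroup : ReTrQuad (Matrix.specialUnitaryGroup n ℂ) :=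
  reTrQuad_ofUnitaryRep (fundamentalRep n) fundamentalRep_mem_unitaryGroup

end Unitary

/-! ## §2  The word expansion: second-order bookkeeping of `Re tr` along a word under exterior perturbation -/

section Word

variable {G : Type*} [GaugeGroup G]

/-- A LETTERED WORD: a list of triples `(g, x, x⁰)` = (fibre factor, NEW exterior factor, OLD exterior factor); the new word
is `Π (g·x)`, the old word `Π (g·x⁰)`.  Every product of group elements in which some factors are changed and the others kept
has this form (kept factors: `x = x⁰ = 1`). [folklore] -/
def wNew (l : List (G × G × G)) : G := (l.map fun t => t.1 * t.2.1).prod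

/-- The OLD word `Π (g·x⁰)`. [folklore] -/
def wOld (l : List (G × G × G)) : G := (l.map fun t => t.1 * t.2.2).prod

/-- The letter deviation `d = (x⁰)⁻¹ x` of a triple. [folklore] -/
def ldev (t : G × G × G) : G := (t.2.2)⁻¹ * t.2.1

/-- TOTAL DEVIATION `δ = Σ_k dist1 d_k`, `d_k = (x_k⁰)⁻¹ x_k` (independent of the fibre factors). [folklore] -/
def wDev (l : List (G × G × G)) : ℝ := (l.map fun t => dist1 (ldev t)).sum

/-- THE FIBRE-INDEPENDENT CONSTANT `κ = Σ_k (reTr d_k − 1)`. [folklore] -/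
def wKap (l : List (G × G × G)) : ℝ := (l.map fun t => reTr (ldev t) - 1).sum

/-- The ordered quadratic term `Σ_{i<k} dist1 d_i · dist1 d_k` (here with the later letters on the right:
`q(t :: l) = dist1 d_t · δ(l) + q(l)`). [folklore] -/
def wQuad : List (G × G × G) → ℝ
  | [] => 0
  | t :: l => dist1 (ldev t) * wDev l + wQuad l

/-- The empty word: `W = 1`. [folklore] -/
@[simp] theorem wNew_nil : wNew ([] : List (G × G × G)) = 1 := by simp [wNew]
/-- The empty word: `W⁰ = 1`. [folklore] -/
@[simp] theorem wOld_nil : wOld ([] : List (G × G × G)) = 1 := by simp [wOld]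
/-- The empty word: `δ = 0`. [folklore] -/
@[simp] theorem wDev_nil : wDev ([] : List (G × G × G)) = 0 := by simp [wDev]
/-- The empty word: `κ = 0`. [folklore] -/
@[simp] theorem wKap_nil : wKap ([] : List (G × G × G)) = 0 := by simp [wKap]
/-- The empty word: `q = 0`. [folklore] -/
@[simp] theorem wQuad_nil : wQuad ([] : List (G × G × G)) = 0 := rfl
/-- `W(t :: l) = g·x·W(l)`. [folklore] -/
@[simp] theorem wNew_cons (t : G × G × G) (l : List (G × G × G)) : wNew (t :: l) = t.1 * t.2.1 * wNew l := by
  simp [wNew]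
/-- `W⁰(t :: l) = g·x⁰·W⁰(l)`. [folklore] -/
@[simp] theorem wOld_cons (t : G × G × G) (l : List (G × G × G)) : wOld (t :: l) = t.1 * t.2.2 * wOld l := by
  simp [wOld]
/-- `δ(t :: l) = dist1 d_t + δ(l)`. [folklore] -/
@[simp] theorem wDev_cons (t : G × G × G) (l : List (G × G × G)) : wDev (t :: l) = dist1 (ldev t) + wDev l := by
  simp [wDev]
/-- `κ(t :: l) = (reTr d_t − 1) + κ(l)`. [folklore] -/
@[simp] theorem wKap_cons (t : G × G × G) (l : List (G × G × G)) : wKap (t :: l) = (reTr (ldev t) - 1) + wKap l := by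
  simp [wKap]
/-- `q(t :: l) = dist1 d_t · δ(l) + q(l)`. [folklore] -/
@[simp] theorem wQuad_cons (t : G × G × G) (l : List (G × G × G)) :
    wQuad (t :: l) = dist1 (ldev t) * wDev l + wQuad l := rfl

/-- `0 ≤ δ`. [folklore] -/
theorem wDev_nonneg (l : List (G × G × G)) : 0 ≤ wDev l := by
  induction l with
  | nil => simp
  | cons t l ih => rw [wDev_cons]; exact add_nonneg (GaugeGroup.dist1_nonneg _) ih

/-- `0 ≤ q`. [folklore] -/
theorem wQuad_nonneg (l : List (G × G × G)) : 0 ≤ wQuad l := by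
  induction l with
  | nil => simp
  | cons t l ih => rw [wQuad_cons]; exact add_nonneg (mul_nonneg (GaugeGroup.dist1_nonneg _) (wDev_nonneg l)) ih

/-- `q ≤ δ²/2`. [folklore] -/
theorem wQuad_le_half_sq (l : List (G × G × G)) : wQuad l ≤ (wDev l) ^ 2 / 2 := by
  induction l with
  | nil => simp
  | cons t l ih =>
    rw [wQuad_cons, wDev_cons]
    nlinarith [sq_nonneg (dist1 (ldev t)), GaugeGroup.dist1_nonneg (ldev t), wDev_nonneg l]

/-- FIRST ORDER IN `dist1`: `|a·W − 1| ≤ |a·W⁰ − 1| + δ` for every left multiplier `a`. [folklore] -/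
theorem dist1_mul_wNew_le (l : List (G × G × G)) :
    ∀ a : G, dist1 (a * wNew l) ≤ dist1 (a * wOld l) + wDev l := by
  induction l with
  | nil => intro a; simp
  | cons t l ih =>
    intro a
    obtain ⟨g, x, x₀⟩ := t
    have hrot : a * (g * x * wNew l) = (a * g * x₀) * ldev (g, x, x₀) * wNew l := by
      simp only [ldev]; group
    calc dist1 (a * wNew ((g, x, x₀) :: l)) = dist1 (wNew l * (a * g * x₀) * ldev (g, x, x₀)) := by
          rw [wNew_cons, hrot, dist1_mul_comm, ← mul_assoc]
      _ ≤ dist1 (wNew l * (a * g * x₀)) + dist1 (ldev (g, x, x₀)) := GaugeGroup.dist1_mul_le _ _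
      _ = dist1 ((a * g * x₀) * wNew l) + dist1 (ldev (g, x, x₀)) := by rw [dist1_mul_comm (wNew l)]
      _ ≤ dist1 ((a * g * x₀) * wOld l) + wDev l + dist1 (ldev (g, x, x₀)) := by linarith [ih (a * g * x₀)]
      _ = dist1 (a * wOld ((g, x, x₀) :: l)) + wDev ((g, x, x₀) :: l) := by
          rw [wOld_cons, wDev_cons]; simp only [mul_assoc]; ring

/-- **THE WORD EXPANSION LEMMA.**  Under `ReTrQuad G`: for every left multiplier `a`,
`|reTr(a·W) − reTr(a·W⁰) − κ| ≤ dist1(a·W⁰)·δ + q` with `κ = Σ_k (reTr d_k − 1)` INDEPENDENT OF THE FIBRE FACTORS,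
`δ = Σ_k dist1 d_k`, `q = Σ_{i<k} dist1 d_i dist1 d_k ≤ δ²/2`.  Proof: replace the exterior letters one at a time; by cyclicity
each replacement reads `reTr(V d) − reTr(V)` for a conjugate `V` of the current word, and `ReTrQuad` prices it
`(reTr d − 1) ± dist1(V)·dist1(d)`. [folklore] -/
theorem abs_reTr_wNew_sub_le (hq : ReTrQuad G) (l : List (G × G × G)) :
    ∀ a : G, |reTr (a * wNew l) - reTr (a * wOld l) - wKap l| ≤ dist1 (a * wOld l) * wDev l + wQuad l := by
  induction l with
  | nil => intro a; simp
  | cons t l ih =>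
    intro a
    obtain ⟨g, x, x₀⟩ := t
    set d := ldev (g, x, x₀) with hd
    set V := wNew l * (a * g * x₀) with hV
    have hrot : a * (g * x * wNew l) = (a * g * x₀) * d * wNew l := by
      simp only [hd, ldev]; group
    have e1 : reTr (a * wNew ((g, x, x₀) :: l)) = reTr (V * d) := by
      rw [wNew_cons, hrot, reTr_mul_comm, ← mul_assoc]
    have e2 : reTr V = reTr ((a * g * x₀) * wNew l) := by rw [hV, reTr_mul_comm]
    have e3 : dist1 V = dist1 ((a * g * x₀) * wNew l) := by rw [hV, dist1_mul_comm]
    have hsplit : reTr (a * wNew ((g, x, x₀) :: l)) - reTr (a * wOld ((g, x, x₀) :: l)) - wKap ((g, x, x₀) :: l)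
        = (reTr (V * d) - reTr V - reTr d + 1)
          + (reTr ((a * g * x₀) * wNew l) - reTr ((a * g * x₀) * wOld l) - wKap l) := by
      rw [e1, e2, wOld_cons, wKap_cons]; simp only [mul_assoc, hd]; ring
    have hδ : 0 ≤ dist1 d := GaugeGroup.dist1_nonneg _
    have hD : 0 ≤ wDev l := wDev_nonneg l
    have h1 : |reTr (V * d) - reTr V - reTr d + 1| ≤ (dist1 ((a * g * x₀) * wOld l) + wDev l) * dist1 d := by
      refine (hq V d).trans (mul_le_mul_of_nonneg_right ?_ hδ)
      rw [e3]; exact dist1_mul_wNew_le l _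
    have h2 := ih (a * g * x₀)
    have hO : dist1 (a * wOld ((g, x, x₀) :: l)) = dist1 ((a * g * x₀) * wOld l) := by
      rw [wOld_cons]; simp only [mul_assoc]
    rw [hsplit, hO, wDev_cons, wQuad_cons]
    refine (abs_add_le _ _).trans ?_
    nlinarith [h1, h2, GaugeGroup.dist1_nonneg ((a * g * x₀) * wOld l)]

/-- The same with `a = 1`. [folklore] -/
theorem abs_reTr_wNew_sub_le' (hq : ReTrQuad G) (l : List (G × G × G)) :
    |reTr (wNew l) - reTr (wOld l) - wKap l| ≤ dist1 (wOld l) * wDev l + (wDev l) ^ 2 / 2 := by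
  have h := abs_reTr_wNew_sub_le hq l 1
  rw [one_mul, one_mul] at h
  exact h.trans (by linarith [wQuad_le_half_sq l])

/-- `|κ| ≤ Lip · δ` under the first-order shape: the subtracted constant is itself of first order in the deviation.
[folklore] -/
theorem abs_wKap_le {Lip : ℝ} (hL : ReTrLip G Lip) (l : List (G × G × G)) : |wKap l| ≤ Lip * wDev l := by
  induction l with
  | nil => simp
  | cons t l ih =>
    rw [wKap_cons, wDev_cons, mul_add]
    exact (abs_add_le _ _).trans (add_le_add (abs_reTr_sub_one_le hL _) ih)

end Word


/-! ## §3  The model: words of bond letters on `T^{(j)}` and the fibre/exterior split through `updateFinset` -/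

section Aux

/-- `Σ_{x ∈ l} f x ≤ |l|·r` when `f ≤ r` on `l`. [folklore] -/
theorem sum_map_le_length_mul {α : Type*} (l : List α) (f : α → ℝ) {r : ℝ} (h : ∀ x ∈ l, f x ≤ r) :
    (l.map f).sum ≤ l.length * r := by
  induction l with
  | nil => simp
  | cons a l ih =>
    simp only [List.map_cons, List.sum_cons, List.length_cons, Nat.cast_succ]
    have h₁ := h a (by simp)
    have h₂ := ih fun x hx => h x (by simp [hx])
    linarith

end Aux

section Model

variable {P : Params} {j : ℕ} {G : Type*}

/-- A LETTER of a lattice word: a positively oriented bond with an orientation flag (`true ↦ U(b)`, `false ↦ U(b)⁻¹`).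
[folklore] -/
abbrev Letter (P : Params) (j : ℕ) : Type := PBond P j × Bool

section UpdateFinset

variable [DecidableEq (PBond P j)]

/-- `(u←y)(b) = y(b)` on the fibre. [folklore] -/
theorem updateFinset_apply_of_mem (u : GaugeField P j G) {s : Finset (PBond P j)} (y : s → G) {b : PBond P j}
    (hb : b ∈ s) : updateFinset u s y b = y ⟨b, hb⟩ := by
  simp [Function.updateFinset, hb]

/-- `(u←y)(b) = u(b)` off the fibre. [folklore] -/
theorem updateFinset_apply_of_not_mem (u : GaugeField P j G) {s : Finset (PBond P j)} (y : s → G) {b : PBond P j}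
    (hb : b ∉ s) : updateFinset u s y b = u b := by
  simp [Function.updateFinset, hb]

end UpdateFinset

variable [GaugeGroup G]

/-- The group element a letter reads off a configuration `U`. [folklore] -/
def letter (U : GaugeField P j G) : Letter P j → G
  | (b, true) => U b
  | (b, false) => (U b)⁻¹

/-- A positively oriented letter reads `U(b)`. [folklore] -/
@[simp] theorem letter_true (U : GaugeField P j G) (b : PBond P j) : letter U (b, true) = U b := rfl
/-- A negatively oriented letter reads `U(b)⁻¹`. [folklore] -/
@[simp] theorem letter_false (U : GaugeField P j G) (b : PBond P j) : letter U (b, false) = (U b)⁻¹ := rfl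

/-- `dist1` of a letter is `dist1` of its bond variable (`dist1_inv`). [folklore] -/
theorem dist1_letter (U : GaugeField P j G) (b : PBond P j) (o : Bool) : dist1 (letter U (b, o)) = dist1 (U b) := by
  cases o
  · exact GaugeGroup.dist1_inv _
  · rfl

/-- The HOLONOMY (ordered product) of a word `w = c₁ ⋯ c_n`: `U(w) = U(c₁) ⋯ U(c_n)`. [folklore] -/
def wordHol (U : GaugeField P j G) (w : List (Letter P j)) : G := (w.map (letter U)).prod

/-- `U(∅) = 1`. [folklore] -/
@[simp] theorem wordHol_nil (U : GaugeField P j G) : wordHol U [] = 1 := by simp [wordHol]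
/-- `U(c w) = U(c) U(w)`. [folklore] -/
@[simp] theorem wordHol_cons (U : GaugeField P j G) (c : Letter P j) (w : List (Letter P j)) :
    wordHol U (c :: w) = letter U c * wordHol U w := by simp [wordHol]

/-- The PLAQUETTE WORD `∂p = ⟨x, x+e_μ⟩ ⟨x+e_μ, x+e_μ+e_ν⟩ ⟨x+e_ν, x+e_ν+e_μ⟩⁻¹ ⟨x, x+e_ν⟩⁻¹` of the tree's plaquette
variable `GaugeField.plaqHol` (B7 (9)). [folklore] -/
def plaqWord (p : Plaq P j) : List (Letter P j) :=
  [(⟨p.src, p.μ⟩, true), (⟨p.src.shift p.μ, p.ν⟩, true), (⟨p.src.shift p.ν, p.μ⟩, false), (⟨p.src, p.ν⟩, false)]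

omit [GaugeGroup G] in
/-- A plaquette word has four letters. [folklore] -/
@[simp] theorem length_plaqWord (p : Plaq P j) : (plaqWord p).length = 4 := rfl

/-- The tree's plaquette variable IS the holonomy of the plaquette word. [folklore] -/
theorem plaqHol_eq_wordHol (U : GaugeField P j G) (p : Plaq P j) :
    GaugeField.plaqHol U p = wordHol U (plaqWord p) := by
  simp [GaugeField.plaqHol, plaqWord, mul_assoc]

/-- First order: `|U(w) − 1| ≤ Σ_{c ∈ w} |U(c) − 1|` (`dist1_mul_le`, `dist1_inv`). [folklore] -/
theorem dist1_wordHol_le (U : GaugeField P j G) (w : List (Letter P j)) :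
    dist1 (wordHol U w) ≤ (w.map fun c => dist1 (U c.1)).sum := by
  induction w with
  | nil => simp [GaugeGroup.dist1_one]
  | cons c w ih =>
    obtain ⟨b, o⟩ := c
    rw [wordHol_cons, List.map_cons, List.sum_cons, ← dist1_letter U b o]
    exact (GaugeGroup.dist1_mul_le _ _).trans (add_le_add le_rfl ih)

/-- The BOND DEVIATION of the exterior `u` from the reference exterior `u₀` at `b`: `u₀(b)⁻¹ u(b)`. [folklore] -/
def bdev (u u₀ : GaugeField P j G) (b : PBond P j) : G := (u₀ b)⁻¹ * u b

/-- `u₀(b)⁻¹ u₀(b) = 1`. [folklore] -/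
@[simp] theorem bdev_self (u₀ : GaugeField P j G) (b : PBond P j) : bdev u₀ u₀ b = 1 := by simp [bdev]

variable [DecidableEq (PBond P j)]

/-- Off the fibre a letter does not see the fibre configuration. [folklore] -/
theorem letter_updateFinset_of_not_mem (u : GaugeField P j G) {s : Finset (PBond P j)} (y : s → G) {b : PBond P j}
    (hb : b ∉ s) (o : Bool) : letter (updateFinset u s y) (b, o) = letter u (b, o) := by
  cases o <;> simp [updateFinset_apply_of_not_mem u y hb]

/-- On the fibre a letter does not see the exterior. [folklore] -/
theorem letter_updateFinset_of_mem (u u₀ : GaugeField P j G) {s : Finset (PBond P j)} (y : s → G) {b : PBond P j}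
    (hb : b ∈ s) (o : Bool) : letter (updateFinset u s y) (b, o) = letter (updateFinset u₀ s y) (b, o) := by
  cases o <;> simp [updateFinset_apply_of_mem _ y hb]

/-- A word with no letter on the fibre does not see the fibre configuration. [folklore] -/
theorem wordHol_updateFinset_of_forall_not_mem (u : GaugeField P j G) {s : Finset (PBond P j)} (y : s → G)
    {w : List (Letter P j)} (hw : ∀ c ∈ w, c.1 ∉ s) : wordHol (updateFinset u s y) w = wordHol u w := by
  induction w with
  | nil => simp
  | cons c w ih =>
    obtain ⟨b, o⟩ := c
    rw [wordHol_cons, wordHol_cons, ih fun c hc => hw c (List.mem_cons.mpr (Or.inr hc)),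
      letter_updateFinset_of_not_mem u y (hw (b, o) (by simp)) o]

/-- THE LETTERED WORD of §2 attached to (fibre `s`, exteriors `u`, `u₀`, fibre configuration `y`): a fibre letter
contributes the triple `(y-letter, 1, 1)`, an exterior letter the triple `(1, u-letter, u₀-letter)`. [folklore] -/
def letterTriple (s : Finset (PBond P j)) (u u₀ : GaugeField P j G) (y : s → G) (c : Letter P j) : G × G × G :=
  if c.1 ∈ s then (letter (updateFinset u₀ s y) c, 1, 1) else (1, letter u c, letter u₀ c)

/-- THE WORD DEVIATION `dev_w(u, u₀) = Σ_{exterior letters c of w} |u₀(c)⁻¹u(c) − 1|` (fibre letters contribute `0`;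
independent of the fibre configuration). [folklore] -/
def wdev (s : Finset (PBond P j)) (u u₀ : GaugeField P j G) (w : List (Letter P j)) : ℝ :=
  (w.map fun c => if c.1 ∈ s then 0 else dist1 (bdev u u₀ c.1)).sum

/-- THE WORD CONSTANT `κ_w(u, u₀) = Σ_{exterior letters c of w} (Re tr(u₀(c)⁻¹u(c)) − 1)` (independent of the fibre
configuration). [folklore] -/
def wkap (s : Finset (PBond P j)) (u u₀ : GaugeField P j G) (w : List (Letter P j)) : ℝ :=
  (w.map fun c => if c.1 ∈ s then 0 else reTr (bdev u u₀ c.1) - 1).sum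

/-- `dev_∅ = 0`. [folklore] -/
@[simp] theorem wdev_nil (s : Finset (PBond P j)) (u u₀ : GaugeField P j G) : wdev s u u₀ [] = 0 := by simp [wdev]
/-- `κ_∅ = 0`. [folklore] -/
@[simp] theorem wkap_nil (s : Finset (PBond P j)) (u u₀ : GaugeField P j G) : wkap s u u₀ [] = 0 := by simp [wkap]
/-- `dev_{c w} = (exterior letter? |u₀(c)⁻¹u(c) − 1| : 0) + dev_w`. [folklore] -/
theorem wdev_cons (s : Finset (PBond P j)) (u u₀ : GaugeField P j G) (c : Letter P j) (w : List (Letter P j)) :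
    wdev s u u₀ (c :: w) = (if c.1 ∈ s then 0 else dist1 (bdev u u₀ c.1)) + wdev s u u₀ w := by simp [wdev]
/-- `κ_{c w} = (exterior letter? Re tr(u₀(c)⁻¹u(c)) − 1 : 0) + κ_w`. [folklore] -/
theorem wkap_cons (s : Finset (PBond P j)) (u u₀ : GaugeField P j G) (c : Letter P j) (w : List (Letter P j)) :
    wkap s u u₀ (c :: w) = (if c.1 ∈ s then 0 else reTr (bdev u u₀ c.1) - 1) + wkap s u u₀ w := by simp [wkap]

/-- `0 ≤ dev_w`. [folklore] -/
theorem wdev_nonneg (s : Finset (PBond P j)) (u u₀ : GaugeField P j G) (w : List (Letter P j)) :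
    0 ≤ wdev s u u₀ w := by
  induction w with
  | nil => simp
  | cons c w ih =>
    rw [wdev_cons]
    refine add_nonneg ?_ ih
    split_ifs
    · exact le_rfl
    · exact GaugeGroup.dist1_nonneg _

/-- `dev_w(u₀, u₀) = 0`. [folklore] -/
@[simp] theorem wdev_self (s : Finset (PBond P j)) (u₀ : GaugeField P j G) (w : List (Letter P j)) :
    wdev s u₀ u₀ w = 0 := by
  induction w with
  | nil => simp
  | cons c w ih => rw [wdev_cons, ih]; simp [GaugeGroup.dist1_one]

/-- `κ_w(u₀, u₀) = 0`. [folklore] -/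
@[simp] theorem wkap_self (s : Finset (PBond P j)) (u₀ : GaugeField P j G) (w : List (Letter P j)) :
    wkap s u₀ u₀ w = 0 := by
  induction w with
  | nil => simp
  | cons c w ih => rw [wkap_cons, ih]; simp [GaugeGroup.reTr_one]

/-- `dev_w ≤ |w|·D` when every exterior letter of `w` deviates by `≤ D` (`0 ≤ D`). [folklore] -/
theorem wdev_le_length_mul (s : Finset (PBond P j)) (u u₀ : GaugeField P j G) (w : List (Letter P j)) {D : ℝ}
    (hD0 : 0 ≤ D) (hD : ∀ c ∈ w, c.1 ∉ s → dist1 (bdev u u₀ c.1) ≤ D) : wdev s u u₀ w ≤ w.length * D := by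
  unfold wdev
  refine sum_map_le_length_mul w _ fun c hc => ?_
  split_ifs with h
  · exact hD0
  · exact hD c hc h

/-- `|κ_w| ≤ Lip · dev_w` under the first-order shape `ReTrLip G Lip`. [folklore] -/
theorem abs_wkap_le {Lip : ℝ} (hL : ReTrLip G Lip) (s : Finset (PBond P j)) (u u₀ : GaugeField P j G)
    (w : List (Letter P j)) : |wkap s u u₀ w| ≤ Lip * wdev s u u₀ w := by
  induction w with
  | nil => simp
  | cons c w ih =>
    rw [wkap_cons, wdev_cons, mul_add]
    refine (abs_add_le _ _).trans (add_le_add ?_ ih)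
    split_ifs
    · simp
    · exact abs_reTr_sub_one_le hL _

/-- BRIDGE: the new word of the lettered word is the holonomy at `u←y`. [folklore] -/
theorem wNew_letterTriple (s : Finset (PBond P j)) (u u₀ : GaugeField P j G) (y : s → G) (w : List (Letter P j)) :
    wNew (w.map (letterTriple s u u₀ y)) = wordHol (updateFinset u s y) w := by
  induction w with
  | nil => simp
  | cons c w ih =>
    obtain ⟨b, o⟩ := c
    rw [List.map_cons, wNew_cons, wordHol_cons, ih]
    congr 1
    by_cases hb : b ∈ s
    · simp [letterTriple, hb, letter_updateFinset_of_mem u u₀ y hb o]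
    · simp [letterTriple, hb, letter_updateFinset_of_not_mem u y hb o]

/-- BRIDGE: the old word of the lettered word is the holonomy at `u₀←y`. [folklore] -/
theorem wOld_letterTriple (s : Finset (PBond P j)) (u u₀ : GaugeField P j G) (y : s → G) (w : List (Letter P j)) :
    wOld (w.map (letterTriple s u u₀ y)) = wordHol (updateFinset u₀ s y) w := by
  induction w with
  | nil => simp
  | cons c w ih =>
    obtain ⟨b, o⟩ := c
    rw [List.map_cons, wOld_cons, wordHol_cons, ih]
    congr 1
    by_cases hb : b ∈ s
    · simp [letterTriple, hb]
    · simp [letterTriple, hb, letter_updateFinset_of_not_mem u₀ y hb o]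

/-- BRIDGE: the total deviation of the lettered word is `dev_w(u,u₀)` (inverse letters by `dist1_mul_inv_eq`).
[folklore] -/
theorem wDev_letterTriple (s : Finset (PBond P j)) (u u₀ : GaugeField P j G) (y : s → G) (w : List (Letter P j)) :
    wDev (w.map (letterTriple s u u₀ y)) = wdev s u u₀ w := by
  induction w with
  | nil => simp
  | cons c w ih =>
    obtain ⟨b, o⟩ := c
    rw [List.map_cons, wDev_cons, wdev_cons, ih]
    congr 1
    by_cases hb : b ∈ s
    · simp [letterTriple, hb, ldev, GaugeGroup.dist1_one]
    · cases o <;> simp [letterTriple, hb, ldev, bdev, dist1_mul_inv_eq]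

/-- BRIDGE: the constant of the lettered word is `κ_w(u,u₀)` (inverse letters by `reTr_mul_inv_eq`). [folklore] -/
theorem wKap_letterTriple (s : Finset (PBond P j)) (u u₀ : GaugeField P j G) (y : s → G) (w : List (Letter P j)) :
    wKap (w.map (letterTriple s u u₀ y)) = wkap s u u₀ w := by
  induction w with
  | nil => simp
  | cons c w ih =>
    obtain ⟨b, o⟩ := c
    rw [List.map_cons, wKap_cons, wkap_cons, ih]
    congr 1
    by_cases hb : b ∈ s
    · simp [letterTriple, hb, ldev, GaugeGroup.reTr_one]
    · cases o <;> simp [letterTriple, hb, ldev, bdev, reTr_mul_inv_eq]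

/-- **THE PER-WORD OSCILLATION BOUND.**  Under `ReTrQuad G`, for every fibre `s`, exteriors `u, u₀`, fibre
configuration `y` and word `w`:
`|Re tr (u←y)(w) − Re tr (u₀←y)(w) − κ_w(u,u₀)| ≤ |(u₀←y)(w) − 1| · dev_w(u,u₀) + dev_w(u,u₀)²/2`,
with `κ_w(u,u₀)` INDEPENDENT OF `y` — the `y`-dependence of the exponent increment is of first order in the
deviation of `u` from `u₀` TIMES the size of the word holonomy, plus second order in the deviation. [folklore] -/
theorem abs_reTr_wordHol_sub_le (hq : ReTrQuad G) (s : Finset (PBond P j)) (u u₀ : GaugeField P j G) (y : s → G)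
    (w : List (Letter P j)) :
    |reTr (wordHol (updateFinset u s y) w) - reTr (wordHol (updateFinset u₀ s y) w) - wkap s u u₀ w|
      ≤ dist1 (wordHol (updateFinset u₀ s y) w) * wdev s u u₀ w + wdev s u u₀ w ^ 2 / 2 := by
  have h := abs_reTr_wNew_sub_le' hq (w.map (letterTriple s u u₀ y))
  rwa [wNew_letterTriple, wOld_letterTriple, wDev_letterTriple, wKap_letterTriple] at h

end Model

/-! ## §4  Finite families of weighted words: the explicit constant `κ(u)` and oscillation `ε(u)` -/

section Sum

variable {P : Params} {j : ℕ} {G : Type*} [GaugeGroup G] {ι : Type*} [Fintype ι]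

/-- The word `w` MEETS the fibre `s`: some letter of `w` lies on a bond of `s`. [folklore] -/
def Meets (s : Finset (PBond P j)) (w : List (Letter P j)) : Prop := ∃ c ∈ w, c.1 ∈ s

/-- A word missing the fibre has all its letters off the fibre. [folklore] -/
theorem forall_not_mem_of_not_meets {s : Finset (PBond P j)} {w : List (Letter P j)} (h : ¬ Meets s w) :
    ∀ c ∈ w, c.1 ∉ s := fun c hc hcs => h ⟨c, hc, hcs⟩

/-- A WILSON-TYPE EXPONENT: `h(U) = Σ_i c_i · Re tr U(w_i)` over a finite family of words with real weights (the
Wilson action `−β Σ_p (1 − Re tr U(∂p))` up to its constant, `exp_neg_mul_wilsonAction`; per-word weights cover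
weighted plaquette families). [folklore] -/
def hsum (c : ι → ℝ) (word : ι → List (Letter P j)) (U : GaugeField P j G) : ℝ := ∑ i, c i * reTr (wordHol U (word i))

/-- Scaling the weights scales the exponent. [folklore] -/
theorem hsum_const_mul (a : ℝ) (c : ι → ℝ) (word : ι → List (Letter P j)) (U : GaugeField P j G) :
    hsum (fun i => a * c i) word U = a * hsum c word U := by
  simp [hsum, Finset.mul_sum, mul_assoc]

/-- THE WILSON ACTION of the tree (`wilsonAction w`, B12 (0.2)) is `|plaquettes|·w − Σ_p w Re tr U(∂p)`. [folklore] -/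
theorem wilsonAction_eq_card_mul_sub_hsum (w : ℝ) (U : GaugeField P j G) :
    wilsonAction w U = Fintype.card (Plaq P j) * w - hsum (fun _ => w) plaqWord U := by
  unfold wilsonAction hsum
  simp_rw [mul_sub, mul_one, plaqHol_eq_wordHol]
  rw [Finset.sum_sub_distrib, Finset.sum_const, Finset.card_univ, nsmul_eq_mul]

/-- … so the Wilson Gibbs factor `e^{−β A_w(U)}` is a CONSTANT times `e^{h(U)}` with `h = Σ_p βw Re tr U(∂p)` of
the treated form. [folklore] -/
theorem exp_neg_mul_wilsonAction (β w : ℝ) (U : GaugeField P j G) :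
    Real.exp (-(β * wilsonAction w U))
      = Real.exp (-(β * (Fintype.card (Plaq P j) * w))) * Real.exp (hsum (fun _ => β * w) plaqWord U) := by
  rw [← Real.exp_add, wilsonAction_eq_card_mul_sub_hsum, hsum_const_mul β (fun _ => w)]
  congr 1
  ring

variable [DecidableEq (PBond P j)]

/-- `Meets s w` is decidable (finite list, decidable bond equality). [folklore] -/
instance decidableMeets (s : Finset (PBond P j)) (w : List (Letter P j)) : Decidable (Meets s w) :=
  inferInstanceAs (Decidable (∃ c ∈ w, c.1 ∈ s))

/-- THE EXPLICIT FREE CONSTANT `κ(u) = Σ_{w_i misses s} c_i (Re tr u(w_i) − Re tr u₀(w_i)) + Σ_{w_i meets s} c_i κ_{w_i}(u,u₀)`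
— the whole exterior-only part of the increment plus the first-order constants of the mixed words. [folklore] -/
def kappa (s : Finset (PBond P j)) (c : ι → ℝ) (word : ι → List (Letter P j)) (u u₀ : GaugeField P j G) : ℝ :=
  ∑ i, c i * (if Meets s (word i) then wkap s u u₀ (word i)
    else reTr (wordHol u (word i)) - reTr (wordHol u₀ (word i)))

/-- THE EXPLICIT OSCILLATION `ε(u) = Σ_{w_i meets s} |c_i| (η_i · dev_{w_i}(u,u₀) + dev_{w_i}(u,u₀)²/2)`, `η_i` a bound
for `|(u₀←y)(w_i) − 1|` on the window: ONLY words meeting the fibre contribute, each at first order in the deviation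
of `u` from `u₀` on ITS OWN exterior letters. [folklore] -/
def eps (s : Finset (PBond P j)) (c : ι → ℝ) (word : ι → List (Letter P j)) (η : ι → ℝ) (u u₀ : GaugeField P j G) :
    ℝ :=
  ∑ i, if Meets s (word i) then |c i| * (η i * wdev s u u₀ (word i) + wdev s u u₀ (word i) ^ 2 / 2) else 0

/-- **THE OSCILLATION THEOREM.**  Under `ReTrQuad G`: if every word meeting the fibre has holonomy within `η_i` of `1`
at the configuration `u₀←y`, then `|h(u←y) − h(u₀←y) − κ(u)| ≤ ε(u)`. [folklore] -/
theorem abs_hsum_sub_le (hq : ReTrQuad G) (s : Finset (PBond P j)) (c : ι → ℝ) (word : ι → List (Letter P j))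
    (η : ι → ℝ) (u u₀ : GaugeField P j G) (y : s → G)
    (hη : ∀ i, Meets s (word i) → dist1 (wordHol (updateFinset u₀ s y) (word i)) ≤ η i) :
    |hsum c word (updateFinset u s y) - hsum c word (updateFinset u₀ s y) - kappa s c word u u₀|
      ≤ eps s c word η u u₀ := by
  unfold hsum kappa eps
  rw [← Finset.sum_sub_distrib, ← Finset.sum_sub_distrib]
  refine (Finset.abs_sum_le_sum_abs _ _).trans (Finset.sum_le_sum fun i _ => ?_)
  by_cases hm : Meets s (word i)
  · rw [if_pos hm, if_pos hm, ← mul_sub, ← mul_sub, abs_mul]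
    refine mul_le_mul_of_nonneg_left ?_ (abs_nonneg _)
    have hw := wdev_nonneg s u u₀ (word i)
    have h1 := abs_reTr_wordHol_sub_le hq s u u₀ y (word i)
    have h2 := mul_le_mul_of_nonneg_right (hη i hm) hw
    linarith
  · have hnm := forall_not_mem_of_not_meets hm
    rw [if_neg hm, if_neg hm, wordHol_updateFinset_of_forall_not_mem u y hnm,
      wordHol_updateFinset_of_forall_not_mem u₀ y hnm, mul_sub, sub_self, abs_zero]

/-- `0 ≤ ε(u)` (for `η ≥ 0`). [folklore] -/
theorem eps_nonneg (s : Finset (PBond P j)) (c : ι → ℝ) (word : ι → List (Letter P j)) {η : ι → ℝ}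
    (hη0 : ∀ i, 0 ≤ η i) (u u₀ : GaugeField P j G) : 0 ≤ eps s c word η u u₀ := by
  refine Finset.sum_nonneg fun i _ => ?_
  split_ifs
  · have hw := wdev_nonneg s u u₀ (word i)
    exact mul_nonneg (abs_nonneg _) (add_nonneg (mul_nonneg (hη0 i) hw) (by positivity))
  · exact le_rfl

/-- `ε(u₀) = 0`. [folklore] -/
@[simp] theorem eps_self (s : Finset (PBond P j)) (c : ι → ℝ) (word : ι → List (Letter P j)) (η : ι → ℝ)
    (u₀ : GaugeField P j G) : eps s c word η u₀ u₀ = 0 := by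
  simp [eps]

/-- `κ(u₀) = 0`. [folklore] -/
@[simp] theorem kappa_self (s : Finset (PBond P j)) (c : ι → ℝ) (word : ι → List (Letter P j))
    (u₀ : GaugeField P j G) : kappa s c word u₀ u₀ = 0 := by
  simp [kappa]

/-- THE COARSE SIZING of `ε(u)`: if `u` deviates from `u₀` by `≤ D` on the exterior letters of the words meeting `s`,
then `ε(u) ≤ Σ_{w_i meets s} |c_i| (η_i |w_i| D + (|w_i| D)²/2)` — FIRST ORDER IN `D` with coefficient
`Σ_{mixed} |c_i| η_i |w_i|`.  (The sizing of `η_i`, `D` and `#{mixed words}` against Bałaban's `g_k^{−2}`, window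
radii and logarithms is NOT this module's: record caveat (LOG-SIZE).) [folklore] -/
theorem eps_le_of_bdev_le (s : Finset (PBond P j)) (c : ι → ℝ) (word : ι → List (Letter P j)) {η : ι → ℝ}
    (hη0 : ∀ i, 0 ≤ η i) (u u₀ : GaugeField P j G) {D : ℝ} (hD0 : 0 ≤ D)
    (hD : ∀ i, Meets s (word i) → ∀ c ∈ word i, c.1 ∉ s → dist1 (bdev u u₀ c.1) ≤ D) :
    eps s c word η u u₀
      ≤ ∑ i, if Meets s (word i) then |c i| * (η i * ((word i).length * D) + ((word i).length * D) ^ 2 / 2) else 0 := by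
  refine Finset.sum_le_sum fun i _ => ?_
  split_ifs with hm
  · have h0 := wdev_nonneg s u u₀ (word i)
    have h1 := wdev_le_length_mul s u u₀ (word i) hD0 (hD i hm)
    have h2 : wdev s u u₀ (word i) ^ 2 ≤ ((word i).length * D) ^ 2 := pow_le_pow_left₀ h0 h1 2
    refine mul_le_mul_of_nonneg_left (add_le_add (mul_le_mul_of_nonneg_left h1 (hη0 i)) ?_) (abs_nonneg _)
    linarith
  · exact le_rfl

end Sum

/-! ## §5  Discharge BY NAME: pv16-g9's `FibreRatioClose` / `tiltDom` for windowed Wilson-type Gibbs densities -/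

section Discharge

/-- Support-restricted twin of `T4TiltModulus.ratioClose_of_exp`: the exponent hypothesis is needed only ON THE
WINDOW `{w ≠ 0}`. [folklore] -/
theorem ratioClose_of_exp_on {S : Type*} {κ ε : ℝ} {w h₁ h₂ : S → ℝ} (hw : 0 ≤ w)
    (hh : ∀ s, w s ≠ 0 → |h₁ s - h₂ s - κ| ≤ ε) :
    RatioClose κ ε (fun s => w s * Real.exp (h₁ s)) (fun s => w s * Real.exp (h₂ s)) := by
  intro s
  by_cases hs : w s = 0
  · simp only [hs, zero_mul, mul_zero]
    exact ⟨le_rfl, le_rfl⟩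
  obtain ⟨hl, hu⟩ := abs_le.mp (hh s hs)
  have e₁ : Real.exp (κ - ε) * Real.exp (h₂ s) ≤ Real.exp (h₁ s) := by
    rw [← Real.exp_add]; exact Real.exp_le_exp.mpr (by linarith)
  have e₂ : Real.exp (h₁ s) ≤ Real.exp (κ + ε) * Real.exp (h₂ s) := by
    rw [← Real.exp_add]; exact Real.exp_le_exp.mpr (by linarith)
  constructor
  · calc Real.exp (κ - ε) * (w s * Real.exp (h₂ s)) = w s * (Real.exp (κ - ε) * Real.exp (h₂ s)) := by ring
      _ ≤ w s * Real.exp (h₁ s) := mul_le_mul_of_nonneg_left e₁ (hw s)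
  · calc w s * Real.exp (h₁ s) ≤ w s * (Real.exp (κ + ε) * Real.exp (h₂ s)) := mul_le_mul_of_nonneg_left e₂ (hw s)
      _ = Real.exp (κ + ε) * (w s * Real.exp (h₂ s)) := by ring

variable {P : Params} {j : ℕ} {G : Type*} [GaugeGroup G] {ι : Type*} [Fintype ι]

section WithFibre

variable [DecidableEq (PBond P j)]

omit [GaugeGroup G] in
/-- Support-restricted twin of `T4TiltModulus.fibreRatioClose_of_exp`: an exterior-blind window `χ ≥ 0` and an
exponent increment oscillating by `≤ ε` about `κ` ON THE SUPPORT of `χ(u₀←·)` give `FibreRatioClose`. [folklore] -/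
theorem fibreRatioClose_of_exp_on (s : Finset (PBond P j)) {χ h : Density P j G} (hχ0 : ∀ U, 0 ≤ χ U)
    {u u₀ : GaugeField P j G} {κ ε : ℝ} (hχ : ∀ y : s → G, χ (updateFinset u s y) = χ (updateFinset u₀ s y))
    (hh : ∀ y : s → G, χ (updateFinset u₀ s y) ≠ 0 → |h (updateFinset u s y) - h (updateFinset u₀ s y) - κ| ≤ ε) :
    FibreRatioClose s (fun U => χ U * Real.exp (h U)) u u₀ κ ε := by
  intro y
  simp only [fibreDensity]
  rw [hχ y]
  exact ratioClose_of_exp_on (w := fun y => χ (updateFinset u₀ s y)) (h₁ := fun y => h (updateFinset u s y))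
    (h₂ := fun y => h (updateFinset u₀ s y)) (fun y => hχ0 _) hh y

/-- HYPOTHESIS SHAPE (window smallness, `u`-INDEPENDENT): on the support of the window along the fibre through `u₀`,
every word of the family meeting the fibre has holonomy within `η_i` of `1`. [folklore] -/
def SmallOnWindow (s : Finset (PBond P j)) (χ : Density P j G) (word : ι → List (Letter P j)) (η : ι → ℝ)
    (u₀ : GaugeField P j G) : Prop :=
  ∀ y : s → G, χ (updateFinset u₀ s y) ≠ 0 →
    ∀ i, Meets s (word i) → dist1 (wordHol (updateFinset u₀ s y) (word i)) ≤ η i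

omit [Fintype ι] in
/-- A window supported in the `η`-small region of the mixed words supplies `SmallOnWindow` at every `u₀`. [folklore] -/
theorem smallOnWindow_of_support {s : Finset (PBond P j)} {χ : Density P j G} {word : ι → List (Letter P j)}
    {η : ι → ℝ} (h : ∀ U, χ U ≠ 0 → ∀ i, Meets s (word i) → dist1 (wordHol U (word i)) ≤ η i)
    (u₀ : GaugeField P j G) : SmallOnWindow s χ word η u₀ :=
  fun _ hy => h _ hy

omit [Fintype ι] in
/-- LETTERWISE SUPPLIER: a window forcing the FIBRE bond variables into `{|· − 1| ≤ r}` and a reference exterior whose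
bond variables on the exterior letters of the mixed words lie in `{|· − 1| ≤ r}` give `SmallOnWindow` with
`η_i = |w_i|·r` (`dist1_wordHol_le`). [folklore] -/
theorem smallOnWindow_of_bondSmall {s : Finset (PBond P j)} {χ : Density P j G} {word : ι → List (Letter P j)}
    {r : ℝ} (hfib : ∀ U, χ U ≠ 0 → ∀ b ∈ s, dist1 (U b) ≤ r) {u₀ : GaugeField P j G}
    (hext : ∀ i, Meets s (word i) → ∀ c ∈ word i, c.1 ∉ s → dist1 (u₀ c.1) ≤ r) :
    SmallOnWindow s χ word (fun i => (word i).length * r) u₀ := by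
  intro y hy i hi
  refine (dist1_wordHol_le _ _).trans (sum_map_le_length_mul _ _ fun c hc => ?_)
  by_cases hc1 : c.1 ∈ s
  · exact hfib _ hy c.1 hc1
  · rw [updateFinset_apply_of_not_mem u₀ y hc1]
    exact hext i hi c hc hc1

/-- **`FibreRatioClose` FOR WINDOWED WILSON-TYPE DENSITIES, EXPLICIT `κ`, `ε`.**  Under `ReTrQuad G`, for
`old = χ·e^{h}`, `h = Σ_i c_i Re tr U(w_i)`, an exterior-blind window `χ ≥ 0` (hypothesis `hχ`, caveat (S-TILT)) and
the window smallness `SmallOnWindow` at `u₀`: `FibreRatioClose s old u u₀ (κ(u)) (ε(u))` with the `kappa` / `eps` of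
§4. [folklore] -/
theorem fibreRatioClose_hsum (hq : ReTrQuad G) (s : Finset (PBond P j)) {χ : Density P j G} (hχ0 : ∀ U, 0 ≤ χ U)
    (c : ι → ℝ) (word : ι → List (Letter P j)) (η : ι → ℝ) {u u₀ : GaugeField P j G}
    (hχ : ∀ y : s → G, χ (updateFinset u s y) = χ (updateFinset u₀ s y)) (hW : SmallOnWindow s χ word η u₀) :
    FibreRatioClose s (fun U => χ U * Real.exp (hsum c word U)) u u₀ (kappa s c word u u₀)
      (eps s c word η u u₀) :=
  fibreRatioClose_of_exp_on s hχ0 hχ fun y hy => abs_hsum_sub_le hq s c word η u u₀ y (hW y hy)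

/-- **MEMBERSHIP IN pv16-g9's TILT DOMAIN** `tiltDom s old u₀ κ ε ε₀` with the EXPLICIT `κ := kappa`, `ε := eps`:
every exterior `u` with `ε(u) ≤ ε₀` (and `η ≥ 0`) belongs to it — so the (T4) theorems of `T4TiltModulus`
(`meanLipschitz_of_tilt`, `pairMeanField_lipschitz_of_tilt`, …) apply at `u` with `dev u = ε(u)` explicit.
[folklore] -/
theorem mem_tiltDom_hsum (hq : ReTrQuad G) (s : Finset (PBond P j)) {χ : Density P j G} (hχ0 : ∀ U, 0 ≤ χ U)
    (c : ι → ℝ) (word : ι → List (Letter P j)) {η : ι → ℝ} (hη0 : ∀ i, 0 ≤ η i) {u u₀ : GaugeField P j G}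
    (hχ : ∀ y : s → G, χ (updateFinset u s y) = χ (updateFinset u₀ s y)) (hW : SmallOnWindow s χ word η u₀)
    {ε₀ : ℝ} (hε : eps s c word η u u₀ ≤ ε₀) :
    u ∈ tiltDom s (fun U => χ U * Real.exp (hsum c word U)) u₀ (fun u => kappa s c word u u₀)
      (fun u => eps s c word η u u₀) ε₀ :=
  ⟨fibreRatioClose_hsum hq s hχ0 c word η hχ hW, eps_nonneg s c word hη0 u u₀, hε⟩

/-- THE WILSON GIBBS FACTOR: for `old = χ·e^{−β A_w(U)}` (`wilsonAction w`), the same with the plaquette words and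
constant weights `βw` (the constant `e^{−β|plaquettes|w}` joins the window). [folklore] -/
theorem fibreRatioClose_wilsonAction (hq : ReTrQuad G) (s : Finset (PBond P j)) {χ : Density P j G}
    (hχ0 : ∀ U, 0 ≤ χ U) (β w : ℝ) (η : Plaq P j → ℝ) {u u₀ : GaugeField P j G}
    (hχ : ∀ y : s → G, χ (updateFinset u s y) = χ (updateFinset u₀ s y)) (hW : SmallOnWindow s χ plaqWord η u₀) :
    FibreRatioClose s (fun U => χ U * Real.exp (-(β * wilsonAction w U))) u u₀
      (kappa s (fun _ => β * w) plaqWord u u₀) (eps s (fun _ => β * w) plaqWord η u u₀) := by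
  have e : (fun U : GaugeField P j G => χ U * Real.exp (-(β * wilsonAction w U)))
      = fun U => (χ U * Real.exp (-(β * (Fintype.card (Plaq P j) * w))))
          * Real.exp (hsum (fun _ => β * w) plaqWord U) := by
    funext U
    rw [exp_neg_mul_wilsonAction, mul_assoc]
  rw [e]
  refine fibreRatioClose_hsum hq s (fun U => mul_nonneg (hχ0 U) (Real.exp_pos _).le) _ _ η
    (fun y => by rw [hχ y]) (fun y hy => hW y fun h0 => hy ?_)
  show χ (updateFinset u₀ s y) * _ = 0
  rw [h0, zero_mul]

/-- … and membership in the tilt domain of the windowed Wilson density. [folklore] -/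
theorem mem_tiltDom_wilsonAction (hq : ReTrQuad G) (s : Finset (PBond P j)) {χ : Density P j G}
    (hχ0 : ∀ U, 0 ≤ χ U) (β w : ℝ) {η : Plaq P j → ℝ} (hη0 : ∀ p, 0 ≤ η p) {u u₀ : GaugeField P j G}
    (hχ : ∀ y : s → G, χ (updateFinset u s y) = χ (updateFinset u₀ s y)) (hW : SmallOnWindow s χ plaqWord η u₀)
    {ε₀ : ℝ} (hε : eps s (fun _ => β * w) plaqWord η u u₀ ≤ ε₀) :
    u ∈ tiltDom s (fun U => χ U * Real.exp (-(β * wilsonAction w U))) u₀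
      (fun u => kappa s (fun _ => β * w) plaqWord u u₀) (fun u => eps s (fun _ => β * w) plaqWord η u u₀) ε₀ :=
  ⟨fibreRatioClose_wilsonAction hq s hχ0 β w η hχ hW, eps_nonneg s _ _ hη0 u u₀, hε⟩

end WithFibre

/-! ### A fully explicit instance: the sharp FIBRE WINDOW (exterior-blind by construction) -/

open Classical in
/-- THE SHARP FIBRE WINDOW `χ_{s,r}(U) = 𝟙{|U(b) − 1| ≤ r for all b ∈ s}` — a window on the FIBRE variables only,
hence exterior-blind on the fibre for EVERY pair of exteriors (`fibreWindow_updateFinset`).  (Whether Bałaban's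
restrictions of the fluctuation variables have this form in the right coordinates is the record's caveat (S-TILT),
not asserted here.) [folklore] -/
def fibreWindow (s : Finset (PBond P j)) (r : ℝ) (U : GaugeField P j G) : ℝ :=
  if ∀ b ∈ s, dist1 (U b) ≤ r then 1 else 0

/-- `0 ≤ χ_{s,r}`. [folklore] -/
theorem fibreWindow_nonneg (s : Finset (PBond P j)) (r : ℝ) (U : GaugeField P j G) : 0 ≤ fibreWindow s r U := by
  unfold fibreWindow
  split_ifs <;> norm_num

/-- On its support the fibre bond variables are `r`-close to `1`. [folklore] -/
theorem fibreWindow_support {s : Finset (PBond P j)} {r : ℝ} {U : GaugeField P j G} (h : fibreWindow s r U ≠ 0) :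
    ∀ b ∈ s, dist1 (U b) ≤ r := by
  unfold fibreWindow at h
  by_contra hc
  exact h (if_neg hc)

variable [DecidableEq (PBond P j)]

/-- EXTERIOR-BLINDNESS of the fibre window: `χ_{s,r}(u←y) = χ_{s,r}(u₀←y)` for all `u, u₀, y`. [folklore] -/
theorem fibreWindow_updateFinset (s : Finset (PBond P j)) (r : ℝ) (u u₀ : GaugeField P j G) (y : s → G) :
    fibreWindow s r (updateFinset u s y) = fibreWindow s r (updateFinset u₀ s y) := by
  have hiff : (∀ b ∈ s, dist1 (updateFinset u s y b) ≤ r) ↔ (∀ b ∈ s, dist1 (updateFinset u₀ s y b) ≤ r) :=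
    forall₂_congr fun b hb => by rw [updateFinset_apply_of_mem u y hb, updateFinset_apply_of_mem u₀ y hb]
  unfold fibreWindow
  by_cases h : ∀ b ∈ s, dist1 (updateFinset u s y b) ≤ r
  · rw [if_pos h, if_pos (hiff.mp h)]
  · rw [if_neg h, if_neg fun h' => h (hiff.mpr h')]

/-- **THE EXPLICIT INSTANCE.**  Under `ReTrQuad G` (e.g. `G = SU(n)`, `reTrQuad_specialUnitaryGroup`): for the
fibre-windowed Wilson density `old = χ_{s,r}·e^{−βA_w}` and a reference exterior `u₀` whose bond variables on the
exterior letters of the plaquettes meeting `s` are `r`-close to `1` (`0 ≤ r`), EVERY exterior `u` with `ε(u) ≤ ε₀`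
lies in `tiltDom s old u₀ κ ε ε₀`, `κ = kappa`, `ε = eps` with `η ≡ 4r`.  No hypothesis of Bałaban's is used;
nothing printed is asserted. [folklore] -/
theorem mem_tiltDom_fibreWindow_wilson (hq : ReTrQuad G) (s : Finset (PBond P j)) {r : ℝ} (hr : 0 ≤ r) (β w : ℝ)
    {u u₀ : GaugeField P j G}
    (hext : ∀ p : Plaq P j, Meets s (plaqWord p) → ∀ c ∈ plaqWord p, c.1 ∉ s → dist1 (u₀ c.1) ≤ r) {ε₀ : ℝ}
    (hε : eps s (fun _ => β * w) plaqWord (fun _ => 4 * r) u u₀ ≤ ε₀) :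
    u ∈ tiltDom s (fun U => fibreWindow s r U * Real.exp (-(β * wilsonAction w U))) u₀
      (fun u => kappa s (fun _ => β * w) plaqWord u u₀)
      (fun u => eps s (fun _ => β * w) plaqWord (fun _ => 4 * r) u u₀) ε₀ := by
  have hW : SmallOnWindow s (fibreWindow s r : Density P j G) plaqWord (fun _ => 4 * r) u₀ := by
    intro y hy p hp
    have h := smallOnWindow_of_bondSmall (word := plaqWord) (fun U hU => fibreWindow_support hU) hext y hy p hp
    simpa only [length_plaqWord, Nat.cast_ofNat] using h
  exact mem_tiltDom_wilsonAction hq s (fibreWindow_nonneg s r) β w (fun _ => by linarith)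
    (fibreWindow_updateFinset s r u u₀) hW hε

open Literature.MathematicalPhysics.QuantumLattice in
/-- **THE EXPLICIT INSTANCE IN `SU(n)`** (the tree's instance `instGaugeGroupSpecialUnitaryGroup`): NO hypothesis
shape left — `ReTrQuad` is discharged by `reTrQuad_specialUnitaryGroup`. [folklore] -/
theorem mem_tiltDom_fibreWindow_wilson_SU {n : Type*} [Fintype n] [DecidableEq n] [Nonempty n]
    (s : Finset (PBond P j)) {r : ℝ} (hr : 0 ≤ r) (β w : ℝ)
    {u u₀ : GaugeField P j (Matrix.specialUnitaryGroup n ℂ)}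
    (hext : ∀ p : Plaq P j, Meets s (plaqWord p) → ∀ c ∈ plaqWord p, c.1 ∉ s → dist1 (u₀ c.1) ≤ r) {ε₀ : ℝ}
    (hε : eps s (fun _ => β * w) plaqWord (fun _ => 4 * r) u u₀ ≤ ε₀) :
    u ∈ tiltDom s (fun U => fibreWindow s r U * Real.exp (-(β * wilsonAction w U))) u₀
      (fun u => kappa s (fun _ => β * w) plaqWord u u₀)
      (fun u => eps s (fun _ => β * w) plaqWord (fun _ => 4 * r) u u₀) ε₀ :=
  mem_tiltDom_fibreWindow_wilson reTrQuad_specialUnitaryGroup s hr β w hext hε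

end Discharge

end Literature.MathematicalPhysics.QuantumFieldTheory.Balaban1983to89.T4TiltOscillation

end
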